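import Summits.CriticalPhenomena.PercolationContinuityZ3.Theorems.Transplant.FKConnectivityAllQForestAdjacentDegThree
import HarnessLib

/-!
# Four marked vertices on a fibre: splitting "three pairwise separated" by the cluster of the fourth (inclusion–exclusion tools)

Support file (`--supports stmt-CriticalPhenomena-4575`), FK sub-lane `prim-bschramm-fk-1` (gen 24) of the post-continuity programme;
builds on p205010 (kernel theorem, internal audit signed; external expert review pending).  No definitions, no named facts, no sorries;
standard axioms.  Pure fibre-count bookkeeping, used by `…ForestHubFourNode` to turn the degree-4 hub decomposition of the square-free
adjacent forest Rayleigh node (`…ForestHubFour`, `hubFour_bad_good_eq`) into its EVENT FORM `good − bad = (M₂ + M₃ − M₁ − D − 2E_ab) + 2E_vy`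
(memo bschramm/FROM-fk-1-g24-HUB-EVENT-CALCULUS.md §1).

For four vertices `v, y, a, b` and any fibre `(N, u)` and second event `B`: the count `#(Fo ∩ {three of them pairwise separated}, B)` splits
according to the open cluster of the fourth vertex `s` — either all four are pairwise separated (`D`), or `s` is joined to EXACTLY ONE of
the three (it cannot be joined to two of them, since those are separated).  The pieces are written canonically with all six pairs
(`vy, va, vb, ya, yb, ab`), the joined pair first, so that the same event arising from different splits is syntactically identical:
* **`fibreCount_sep_vya_split`** (fourth vertex `b`): `#(¬vy ∧ ¬va ∧ ¬ya) = D + E_vb + E_yb + E_ab`,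
* **`fibreCount_sep_vyb_split`** (fourth vertex `a`): `#(¬vy ∧ ¬vb ∧ ¬yb) = D + E_va + E_ya + E_ab`,
* **`fibreCount_sep_vab_split`** (fourth vertex `y`): `#(¬va ∧ ¬vb ∧ ¬ab) = D + E_vy + E_ya + E_yb`,
* **`fibreCount_sep_yab_split`** (fourth vertex `v`): `#(¬ya ∧ ¬yb ∧ ¬ab) = D + E_vy + E_va + E_vb`.
[cite: Linusson2011, Prop. 2.6] [cite: SempleWelsh2008, Conj. 1.1 (p. 2)]
-/

noncomputable section

namespace Summit.CriticalPhenomena.PercolationContinuityZ3.Theorems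
namespace FK

open MeasureTheory Set Literature.Probability.LatticeModels Literature.Probability.Percolation
open scoped Classical symmDiff

variable {V : Type*} [Fintype V]

/-! ### Inclusion–exclusion on the rest: three separated terminals, split by the cluster of the fourth -/

/-- Splitting `#(Fo ∩ {v, y, a pairwise separated}, B)` by the cluster of `b`: all four separated (`D`), or `b` joined to exactly one of
`v, y, a` (`E_vb`, `E_yb`, `E_ab`; events written with all six pairs, the joined pair first). [cite: Linusson2011, Prop. 2.6] -/
theorem fibreCount_sep_vya_split (N u : BondConfig V) (B : Set (BondConfig V)) (v y a b : V) :
    fibreCount N u (forestEv V ∩ {ω | ¬ (openGraph ω).Reachable v y ∧ ¬ (openGraph ω).Reachable v a ∧ ¬ (openGraph ω).Reachable y a}) B =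
      fibreCount N u (forestEv V ∩ {ω | ¬ (openGraph ω).Reachable v y ∧ ¬ (openGraph ω).Reachable v a ∧ ¬ (openGraph ω).Reachable v b ∧
          ¬ (openGraph ω).Reachable y a ∧ ¬ (openGraph ω).Reachable y b ∧ ¬ (openGraph ω).Reachable a b}) B +
      fibreCount N u (forestEv V ∩ {ω | (openGraph ω).Reachable v b ∧ ¬ (openGraph ω).Reachable v y ∧ ¬ (openGraph ω).Reachable v a ∧
          ¬ (openGraph ω).Reachable y a ∧ ¬ (openGraph ω).Reachable y b ∧ ¬ (openGraph ω).Reachable a b}) B +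
      fibreCount N u (forestEv V ∩ {ω | (openGraph ω).Reachable y b ∧ ¬ (openGraph ω).Reachable v y ∧ ¬ (openGraph ω).Reachable v a ∧
          ¬ (openGraph ω).Reachable v b ∧ ¬ (openGraph ω).Reachable y a ∧ ¬ (openGraph ω).Reachable a b}) B +
      fibreCount N u (forestEv V ∩ {ω | (openGraph ω).Reachable a b ∧ ¬ (openGraph ω).Reachable v y ∧ ¬ (openGraph ω).Reachable v a ∧
          ¬ (openGraph ω).Reachable v b ∧ ¬ (openGraph ω).Reachable y a ∧ ¬ (openGraph ω).Reachable y b}) B := by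
  set D : Set (BondConfig V) := forestEv V ∩ {ω | ¬ (openGraph ω).Reachable v y ∧ ¬ (openGraph ω).Reachable v a ∧
    ¬ (openGraph ω).Reachable v b ∧ ¬ (openGraph ω).Reachable y a ∧ ¬ (openGraph ω).Reachable y b ∧ ¬ (openGraph ω).Reachable a b} with hD
  set E₁ : Set (BondConfig V) := forestEv V ∩ {ω | (openGraph ω).Reachable v b ∧ ¬ (openGraph ω).Reachable v y ∧
    ¬ (openGraph ω).Reachable v a ∧ ¬ (openGraph ω).Reachable y a ∧ ¬ (openGraph ω).Reachable y b ∧ ¬ (openGraph ω).Reachable a b} with hE₁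
  set E₂ : Set (BondConfig V) := forestEv V ∩ {ω | (openGraph ω).Reachable y b ∧ ¬ (openGraph ω).Reachable v y ∧
    ¬ (openGraph ω).Reachable v a ∧ ¬ (openGraph ω).Reachable v b ∧ ¬ (openGraph ω).Reachable y a ∧ ¬ (openGraph ω).Reachable a b} with hE₂
  set E₃ : Set (BondConfig V) := forestEv V ∩ {ω | (openGraph ω).Reachable a b ∧ ¬ (openGraph ω).Reachable v y ∧
    ¬ (openGraph ω).Reachable v a ∧ ¬ (openGraph ω).Reachable v b ∧ ¬ (openGraph ω).Reachable y a ∧ ¬ (openGraph ω).Reachable y b} with hE₃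
  have hd1 : Disjoint D E₁ := Set.disjoint_left.2 fun ω h₁ h₂ => h₁.2.2.2.1 h₂.2.1
  have hd2 : Disjoint (D ∪ E₁) E₂ := Set.disjoint_left.2 fun ω h₁ h₂ => by
    rcases h₁ with h | h <;> exact h.2.2.2.2.2.1 h₂.2.1
  have hd3 : Disjoint (D ∪ E₁ ∪ E₂) E₃ := Set.disjoint_left.2 fun ω h₁ h₂ => by
    rcases h₁ with (h | h) | h <;> exact h.2.2.2.2.2.2 h₂.2.1
  rw [← fibreCount_split_left N u B hd1, ← fibreCount_split_left N u B hd2, ← fibreCount_split_left N u B hd3]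
  refine fibreCount_congr_fibre N u fun ω _ => ⟨fun ⟨⟨hF, h1, h2, h3⟩, hB⟩ => ⟨?_, hB⟩, fun ⟨hA, hB⟩ => ⟨?_, hB⟩⟩
  · by_cases hvb : (openGraph ω).Reachable v b
    · exact Or.inl (Or.inl (Or.inr ⟨hF, hvb, h1, h2, h3, fun h => h1 (hvb.trans h.symm), fun h => h2 (hvb.trans h.symm)⟩))
    · by_cases hyb : (openGraph ω).Reachable y b
      · exact Or.inl (Or.inr ⟨hF, hyb, h1, h2, hvb, h3, fun h => h3 (hyb.trans h.symm)⟩)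
      · by_cases hab : (openGraph ω).Reachable a b
        · exact Or.inr ⟨hF, hab, h1, h2, hvb, h3, hyb⟩
        · exact Or.inl (Or.inl (Or.inl ⟨hF, h1, h2, hvb, h3, hyb, hab⟩))
  · rcases hA with ((⟨hF, h1, h2, -, h3, -, -⟩ | ⟨hF, -, h1, h2, h3, -, -⟩) | ⟨hF, -, h1, h2, -, h3, -⟩) | ⟨hF, -, h1, h2, -, h3, -⟩ <;>
      exact ⟨hF, h1, h2, h3⟩

/-- Splitting `#(Fo ∩ {v, y, b pairwise separated}, B)` by the cluster of `a`: all four separated (`D`), or `a` joined to exactly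
one of them (events written with all six pairs, the joined pair first). [cite: Linusson2011, Prop. 2.6] -/
theorem fibreCount_sep_vyb_split (N u : BondConfig V) (B : Set (BondConfig V)) (v y a b : V) :
    fibreCount N u (forestEv V ∩ {ω | ¬ (openGraph ω).Reachable v y ∧ ¬ (openGraph ω).Reachable v b ∧ ¬ (openGraph ω).Reachable y b}) B =
      fibreCount N u (forestEv V ∩ {ω | ¬ (openGraph ω).Reachable v y ∧ ¬ (openGraph ω).Reachable v a ∧ ¬ (openGraph ω).Reachable v b ∧
          ¬ (openGraph ω).Reachable y a ∧ ¬ (openGraph ω).Reachable y b ∧ ¬ (openGraph ω).Reachable a b}) B +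
      fibreCount N u (forestEv V ∩ {ω | (openGraph ω).Reachable v a ∧ ¬ (openGraph ω).Reachable v y ∧ ¬ (openGraph ω).Reachable v b ∧
          ¬ (openGraph ω).Reachable y a ∧ ¬ (openGraph ω).Reachable y b ∧ ¬ (openGraph ω).Reachable a b}) B +
      fibreCount N u (forestEv V ∩ {ω | (openGraph ω).Reachable y a ∧ ¬ (openGraph ω).Reachable v y ∧ ¬ (openGraph ω).Reachable v a ∧
          ¬ (openGraph ω).Reachable v b ∧ ¬ (openGraph ω).Reachable y b ∧ ¬ (openGraph ω).Reachable a b}) B +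
      fibreCount N u (forestEv V ∩ {ω | (openGraph ω).Reachable a b ∧ ¬ (openGraph ω).Reachable v y ∧ ¬ (openGraph ω).Reachable v a ∧
          ¬ (openGraph ω).Reachable v b ∧ ¬ (openGraph ω).Reachable y a ∧ ¬ (openGraph ω).Reachable y b}) B := by
  set D : Set (BondConfig V) := forestEv V ∩ {ω | ¬ (openGraph ω).Reachable v y ∧ ¬ (openGraph ω).Reachable v a ∧ ¬ (openGraph ω).Reachable v b ∧
    ¬ (openGraph ω).Reachable y a ∧ ¬ (openGraph ω).Reachable y b ∧ ¬ (openGraph ω).Reachable a b} with hD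
  set E₁ : Set (BondConfig V) := forestEv V ∩ {ω | (openGraph ω).Reachable v a ∧ ¬ (openGraph ω).Reachable v y ∧ ¬ (openGraph ω).Reachable v b ∧
    ¬ (openGraph ω).Reachable y a ∧ ¬ (openGraph ω).Reachable y b ∧ ¬ (openGraph ω).Reachable a b} with hE₁
  set E₂ : Set (BondConfig V) := forestEv V ∩ {ω | (openGraph ω).Reachable y a ∧ ¬ (openGraph ω).Reachable v y ∧ ¬ (openGraph ω).Reachable v a ∧
    ¬ (openGraph ω).Reachable v b ∧ ¬ (openGraph ω).Reachable y b ∧ ¬ (openGraph ω).Reachable a b} with hE₂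
  set E₃ : Set (BondConfig V) := forestEv V ∩ {ω | (openGraph ω).Reachable a b ∧ ¬ (openGraph ω).Reachable v y ∧ ¬ (openGraph ω).Reachable v a ∧
    ¬ (openGraph ω).Reachable v b ∧ ¬ (openGraph ω).Reachable y a ∧ ¬ (openGraph ω).Reachable y b} with hE₃
  have hd1 : Disjoint D E₁ := Set.disjoint_left.2 fun ω h₁ h₂ => h₁.2.2.1 h₂.2.1
  have hd2 : Disjoint (D ∪ E₁) E₂ := Set.disjoint_left.2 fun ω h₁ h₂ => by
    rcases h₁ with h | h <;> exact h.2.2.2.2.1 h₂.2.1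
  have hd3 : Disjoint (D ∪ E₁ ∪ E₂) E₃ := Set.disjoint_left.2 fun ω h₁ h₂ => by
    rcases h₁ with (h | h) | h <;> exact h.2.2.2.2.2.2 h₂.2.1
  rw [← fibreCount_split_left N u B hd1, ← fibreCount_split_left N u B hd2, ← fibreCount_split_left N u B hd3]
  refine fibreCount_congr_fibre N u fun ω _ => ⟨fun ⟨⟨hF, h1, h2, h3⟩, hB⟩ => ⟨?_, hB⟩, fun ⟨hA, hB⟩ => ⟨?_, hB⟩⟩
  · by_cases hva : (openGraph ω).Reachable v a
    · exact Or.inl (Or.inl (Or.inr ⟨hF, hva, h1, h2, fun h => h1 (hva.trans h.symm), h3, fun h => h2 (hva.trans h)⟩))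
    · by_cases hya : (openGraph ω).Reachable y a
      · exact Or.inl (Or.inr ⟨hF, hya, h1, hva, h2, h3, fun h => h3 (hya.trans h)⟩)
      · by_cases hab : (openGraph ω).Reachable a b
        · exact Or.inr ⟨hF, hab, h1, hva, h2, hya, h3⟩
        · exact Or.inl (Or.inl (Or.inl ⟨hF, h1, hva, h2, hya, h3, hab⟩))
  · rcases hA with ((⟨hF, h1, -, h2, -, h3, -⟩ | ⟨hF, -, h1, h2, -, h3, -⟩) | ⟨hF, -, h1, -, h2, h3, -⟩) | ⟨hF, -, h1, -, h2, -, h3⟩ <;>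
      exact ⟨hF, h1, h2, h3⟩

/-- Splitting `#(Fo ∩ {v, a, b pairwise separated}, B)` by the cluster of `y`: all four separated (`D`), or `y` joined to exactly
one of them (events written with all six pairs, the joined pair first). [cite: Linusson2011, Prop. 2.6] -/
theorem fibreCount_sep_vab_split (N u : BondConfig V) (B : Set (BondConfig V)) (v y a b : V) :
    fibreCount N u (forestEv V ∩ {ω | ¬ (openGraph ω).Reachable v a ∧ ¬ (openGraph ω).Reachable v b ∧ ¬ (openGraph ω).Reachable a b}) B =
      fibreCount N u (forestEv V ∩ {ω | ¬ (openGraph ω).Reachable v y ∧ ¬ (openGraph ω).Reachable v a ∧ ¬ (openGraph ω).Reachable v b ∧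
          ¬ (openGraph ω).Reachable y a ∧ ¬ (openGraph ω).Reachable y b ∧ ¬ (openGraph ω).Reachable a b}) B +
      fibreCount N u (forestEv V ∩ {ω | (openGraph ω).Reachable v y ∧ ¬ (openGraph ω).Reachable v a ∧ ¬ (openGraph ω).Reachable v b ∧
          ¬ (openGraph ω).Reachable y a ∧ ¬ (openGraph ω).Reachable y b ∧ ¬ (openGraph ω).Reachable a b}) B +
      fibreCount N u (forestEv V ∩ {ω | (openGraph ω).Reachable y a ∧ ¬ (openGraph ω).Reachable v y ∧ ¬ (openGraph ω).Reachable v a ∧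
          ¬ (openGraph ω).Reachable v b ∧ ¬ (openGraph ω).Reachable y b ∧ ¬ (openGraph ω).Reachable a b}) B +
      fibreCount N u (forestEv V ∩ {ω | (openGraph ω).Reachable y b ∧ ¬ (openGraph ω).Reachable v y ∧ ¬ (openGraph ω).Reachable v a ∧
          ¬ (openGraph ω).Reachable v b ∧ ¬ (openGraph ω).Reachable y a ∧ ¬ (openGraph ω).Reachable a b}) B := by
  set D : Set (BondConfig V) := forestEv V ∩ {ω | ¬ (openGraph ω).Reachable v y ∧ ¬ (openGraph ω).Reachable v a ∧ ¬ (openGraph ω).Reachable v b ∧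
    ¬ (openGraph ω).Reachable y a ∧ ¬ (openGraph ω).Reachable y b ∧ ¬ (openGraph ω).Reachable a b} with hD
  set E₁ : Set (BondConfig V) := forestEv V ∩ {ω | (openGraph ω).Reachable v y ∧ ¬ (openGraph ω).Reachable v a ∧ ¬ (openGraph ω).Reachable v b ∧
    ¬ (openGraph ω).Reachable y a ∧ ¬ (openGraph ω).Reachable y b ∧ ¬ (openGraph ω).Reachable a b} with hE₁
  set E₂ : Set (BondConfig V) := forestEv V ∩ {ω | (openGraph ω).Reachable y a ∧ ¬ (openGraph ω).Reachable v y ∧ ¬ (openGraph ω).Reachable v a ∧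
    ¬ (openGraph ω).Reachable v b ∧ ¬ (openGraph ω).Reachable y b ∧ ¬ (openGraph ω).Reachable a b} with hE₂
  set E₃ : Set (BondConfig V) := forestEv V ∩ {ω | (openGraph ω).Reachable y b ∧ ¬ (openGraph ω).Reachable v y ∧ ¬ (openGraph ω).Reachable v a ∧
    ¬ (openGraph ω).Reachable v b ∧ ¬ (openGraph ω).Reachable y a ∧ ¬ (openGraph ω).Reachable a b} with hE₃
  have hd1 : Disjoint D E₁ := Set.disjoint_left.2 fun ω h₁ h₂ => h₁.2.1 h₂.2.1
  have hd2 : Disjoint (D ∪ E₁) E₂ := Set.disjoint_left.2 fun ω h₁ h₂ => by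
    rcases h₁ with h | h <;> exact h.2.2.2.2.1 h₂.2.1
  have hd3 : Disjoint (D ∪ E₁ ∪ E₂) E₃ := Set.disjoint_left.2 fun ω h₁ h₂ => by
    rcases h₁ with (h | h) | h <;> exact h.2.2.2.2.2.1 h₂.2.1
  rw [← fibreCount_split_left N u B hd1, ← fibreCount_split_left N u B hd2, ← fibreCount_split_left N u B hd3]
  refine fibreCount_congr_fibre N u fun ω _ => ⟨fun ⟨⟨hF, h1, h2, h3⟩, hB⟩ => ⟨?_, hB⟩, fun ⟨hA, hB⟩ => ⟨?_, hB⟩⟩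
  · by_cases hvy : (openGraph ω).Reachable v y
    · exact Or.inl (Or.inl (Or.inr ⟨hF, hvy, h1, h2, fun h => h1 (hvy.trans h), fun h => h2 (hvy.trans h), h3⟩))
    · by_cases hya : (openGraph ω).Reachable y a
      · exact Or.inl (Or.inr ⟨hF, hya, hvy, h1, h2, fun h => h3 (hya.symm.trans h), h3⟩)
      · by_cases hyb : (openGraph ω).Reachable y b
        · exact Or.inr ⟨hF, hyb, hvy, h1, h2, hya, h3⟩
        · exact Or.inl (Or.inl (Or.inl ⟨hF, hvy, h1, h2, hya, hyb, h3⟩))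
  · rcases hA with ((⟨hF, -, h1, h2, -, -, h3⟩ | ⟨hF, -, h1, h2, -, -, h3⟩) | ⟨hF, -, -, h1, h2, -, h3⟩) | ⟨hF, -, -, h1, h2, -, h3⟩ <;>
      exact ⟨hF, h1, h2, h3⟩

/-- Splitting `#(Fo ∩ {y, a, b pairwise separated}, B)` by the cluster of `v`: all four separated (`D`), or `v` joined to exactly
one of them (events written with all six pairs, the joined pair first). [cite: Linusson2011, Prop. 2.6] -/
theorem fibreCount_sep_yab_split (N u : BondConfig V) (B : Set (BondConfig V)) (v y a b : V) :
    fibreCount N u (forestEv V ∩ {ω | ¬ (openGraph ω).Reachable y a ∧ ¬ (openGraph ω).Reachable y b ∧ ¬ (openGraph ω).Reachable a b}) B =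
      fibreCount N u (forestEv V ∩ {ω | ¬ (openGraph ω).Reachable v y ∧ ¬ (openGraph ω).Reachable v a ∧ ¬ (openGraph ω).Reachable v b ∧
          ¬ (openGraph ω).Reachable y a ∧ ¬ (openGraph ω).Reachable y b ∧ ¬ (openGraph ω).Reachable a b}) B +
      fibreCount N u (forestEv V ∩ {ω | (openGraph ω).Reachable v y ∧ ¬ (openGraph ω).Reachable v a ∧ ¬ (openGraph ω).Reachable v b ∧
          ¬ (openGraph ω).Reachable y a ∧ ¬ (openGraph ω).Reachable y b ∧ ¬ (openGraph ω).Reachable a b}) B +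
      fibreCount N u (forestEv V ∩ {ω | (openGraph ω).Reachable v a ∧ ¬ (openGraph ω).Reachable v y ∧ ¬ (openGraph ω).Reachable v b ∧
          ¬ (openGraph ω).Reachable y a ∧ ¬ (openGraph ω).Reachable y b ∧ ¬ (openGraph ω).Reachable a b}) B +
      fibreCount N u (forestEv V ∩ {ω | (openGraph ω).Reachable v b ∧ ¬ (openGraph ω).Reachable v y ∧ ¬ (openGraph ω).Reachable v a ∧
          ¬ (openGraph ω).Reachable y a ∧ ¬ (openGraph ω).Reachable y b ∧ ¬ (openGraph ω).Reachable a b}) B := by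
  set D : Set (BondConfig V) := forestEv V ∩ {ω | ¬ (openGraph ω).Reachable v y ∧ ¬ (openGraph ω).Reachable v a ∧ ¬ (openGraph ω).Reachable v b ∧
    ¬ (openGraph ω).Reachable y a ∧ ¬ (openGraph ω).Reachable y b ∧ ¬ (openGraph ω).Reachable a b} with hD
  set E₁ : Set (BondConfig V) := forestEv V ∩ {ω | (openGraph ω).Reachable v y ∧ ¬ (openGraph ω).Reachable v a ∧ ¬ (openGraph ω).Reachable v b ∧
    ¬ (openGraph ω).Reachable y a ∧ ¬ (openGraph ω).Reachable y b ∧ ¬ (openGraph ω).Reachable a b} with hE₁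
  set E₂ : Set (BondConfig V) := forestEv V ∩ {ω | (openGraph ω).Reachable v a ∧ ¬ (openGraph ω).Reachable v y ∧ ¬ (openGraph ω).Reachable v b ∧
    ¬ (openGraph ω).Reachable y a ∧ ¬ (openGraph ω).Reachable y b ∧ ¬ (openGraph ω).Reachable a b} with hE₂
  set E₃ : Set (BondConfig V) := forestEv V ∩ {ω | (openGraph ω).Reachable v b ∧ ¬ (openGraph ω).Reachable v y ∧ ¬ (openGraph ω).Reachable v a ∧
    ¬ (openGraph ω).Reachable y a ∧ ¬ (openGraph ω).Reachable y b ∧ ¬ (openGraph ω).Reachable a b} with hE₃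
  have hd1 : Disjoint D E₁ := Set.disjoint_left.2 fun ω h₁ h₂ => h₁.2.1 h₂.2.1
  have hd2 : Disjoint (D ∪ E₁) E₂ := Set.disjoint_left.2 fun ω h₁ h₂ => by
    rcases h₁ with h | h <;> exact h.2.2.1 h₂.2.1
  have hd3 : Disjoint (D ∪ E₁ ∪ E₂) E₃ := Set.disjoint_left.2 fun ω h₁ h₂ => by
    rcases h₁ with (h | h) | h <;> exact h.2.2.2.1 h₂.2.1
  rw [← fibreCount_split_left N u B hd1, ← fibreCount_split_left N u B hd2, ← fibreCount_split_left N u B hd3]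
  refine fibreCount_congr_fibre N u fun ω _ => ⟨fun ⟨⟨hF, h1, h2, h3⟩, hB⟩ => ⟨?_, hB⟩, fun ⟨hA, hB⟩ => ⟨?_, hB⟩⟩
  · by_cases hvy : (openGraph ω).Reachable v y
    · exact Or.inl (Or.inl (Or.inr ⟨hF, hvy, fun h => h1 (hvy.symm.trans h), fun h => h2 (hvy.symm.trans h), h1, h2, h3⟩))
    · by_cases hva : (openGraph ω).Reachable v a
      · exact Or.inl (Or.inr ⟨hF, hva, hvy, fun h => h3 (hva.symm.trans h), h1, h2, h3⟩)
      · by_cases hvb : (openGraph ω).Reachable v b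
        · exact Or.inr ⟨hF, hvb, hvy, hva, h1, h2, h3⟩
        · exact Or.inl (Or.inl (Or.inl ⟨hF, hvy, hva, hvb, h1, h2, h3⟩))
  · rcases hA with ((⟨hF, -, -, -, h1, h2, h3⟩ | ⟨hF, -, -, -, h1, h2, h3⟩) | ⟨hF, -, -, -, h1, h2, h3⟩) | ⟨hF, -, -, -, h1, h2, h3⟩ <;>
      exact ⟨hF, h1, h2, h3⟩

end FK
end Summit.CriticalPhenomena.PercolationContinuityZ3.Theorems

end
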